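import Summits.PneNP.PneNP.Theorems.SzkEntropyPeaThreeNotInPLatticeAssembly
import Summits.PneNP.PneNP.Theorems.SzkEntropyPeaThreeNotInPCoreStubReduction
import HarnessLib

/-!
# Crux `PeaThreeNotInP` (stmt-PneNP-10776) — line `SketchIdeator3`, SKELETON v7 (c2 lead, FINAL of cycle 3)

Everything provable has LANDED.  Two certified imports now end at OPEN hardness hypotheses:

* (v5, leads 0/1) `peaThreeNotInP_of_tensorIsoFull : TensorIsoFull ∉ PromiseP → PeaThreeNotInP`
  (3-Tensor Isomorphism over `F₂` not in `P`; `Theorems/SzkEntropyPeaThreeNotInPCoreStubReduction.lean`);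
* (v6→v7, this seat) `peaThreeNotInP_of_latticeGapsvpNNotP : LatticeGapsvpNNotP → PeaThreeNotInP`
  (`GapSVP_n ∉ PromiseP`, the retired Lattice route's thesis; `Theorems/SzkEntropyPeaThreeNotInPLatticeAssembly.lean`,
  over Defs p137610/p138057 and stubs `stub_affineFP` p138495, `stub_reindex` p138512, `stub_params` p138567,
  `stub_bpSemantics` p138583, `stub_geometry` p138746, `stub_overlap` p138782, `stub_instanceFP` p138947,
  `stub_gap` (prep p139440 + main), i.e. the Karp reduction `gapCVPPromise (fun n => n) ≤ₚ (PEDBPGap 1 10).swap`).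

Sole `sorry`: the conjecture stub `stub_latticeGapsvpNNotP_hard` (OPEN; crux-sized by nature — it is ≥ X, as every
hardness import must be once its reduction is certified, cf. STRATEGY-CENSUS.md O1/D1).
-/

namespace Summit.PneNP.PneNP.Cruxes.PeaThreeNotInP.LatticeLine

set_option linter.dupNamespace false -- `Summit.PneNP.PneNP.…`: summit = sub-problem name (D-0017)

open Summit.PneNP.PneNP.Theses.SzkEntropy (PeaThreeNotInP)
open Summit.PneNP.PneNP.Theses.Lattice (LatticeGapsvpNNotP)

/-- **(conjecture stub, OPEN)** the retired Lattice route's thesis: `GapSVP_n ∉ PromiseP`.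
[cite: AharonovRegev2005, §1] -/
theorem stub_latticeGapsvpNNotP_hard : LatticeGapsvpNNotP := by
  sorry

/-- **The composition of the line**: the crux from the conjecture stub, through the LANDED lattice import. -/
theorem PeaThreeNotInP_of : PeaThreeNotInP :=
  peaThreeNotInP_of_latticeGapsvpNNotP stub_latticeGapsvpNNotP_hard

end Summit.PneNP.PneNP.Cruxes.PeaThreeNotInP.LatticeLine
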